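import Literature.Analysis.FluidPDE.AxisymQuotientEquationsOmega
import Literature.Analysis.FluidPDE.SpaceTimeParametricIntegral
import HarnessLib

/-!
# The Hou–Li variables along a jointly smooth flow: joint smoothness on the slab and
# `∂ₜ (radQuot S) = radQuot (∂ₜ S)`

Analysis/FluidPDE support file (all results proved; no definitions, no named facts) on the
decomposition path of the named fact
`Literature.Analysis.FluidPDE.LeiZhang2017_smallSwirl_regularity` (Lei–Zhang 2017, Thm. 1.4).

The energy method of Lei–Zhang 2017, §4, integrates in time quantities such as `∫ Ω(t)²`,
`∫ r² Φ(t)⁴` built from the smooth Hou–Li variables `Φ = angVelQuot (u t) = u^θ/r`,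
`Ω = angVortQuot (u t) = ω^θ/r`, `W = radVelQuot (u t) = uʳ/r` (`AxisymHouLiVariables.lean`) of a
classical solution `u`, jointly smooth on a slab `S × ℝ³` (`IsSmoothSpaceTimeOn S u`, `S` a
non-degenerate interval, endpoints allowed).  The pointwise equations of the tree
(`IsClassicalNSSolutionOn.angVelQuot_eq`, `.angVortQuot_eq`) are written with the quotients of
the time derivative, `angVelQuot (∂ₜu t)`, …; to run `d/dt` under `∫` one needs the time
derivatives of the quotient FAMILIES.  This file supplies:

* `IsSmoothSpaceTimeOn.hadamardQuotFst_family`, `.radDerivQuot_family`, `.radQuot_family` — for a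
  scalar family `F` jointly smooth on `S × ℝ³` (`S` convex, of unique differentiability), the
  families `t ↦ hadamardQuotFst (F t)`, `radDerivQuot (F t)`, `radQuot (F t)` are jointly smooth on
  `S × ℝ³` (parametric interval integrals of integrands smooth within `univ × (S × ℝ³)`,
  `contDiffOn_parametric_intervalIntegral_prod`, endpoints of `S` included);
* `IsSmoothSpaceTimeOn.swirl_family`, `.horizontalInner_family`, `.angVelQuot_family`,
  `.angVortQuot_family`, `.radVelQuot_family` — hence `Γ = swirl (u t)`, `x₀u₀ + x₁u₁`, `Φ`, `Ω`,
  `W` are jointly smooth along a jointly smooth `u`;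
* `IsSmoothSpaceTimeOn.timeDerivWithin_radQuot` — **`∂ₜ (radQuot (F ·)) (t) = radQuot (∂ₜF t)`**
  at every point (axis included) for axisymmetric slices `F s`: off the plane `{x₀ = 0}` from
  Hadamard's identity `r² radQuot (F s) x = F s x − F s (0, 0, x₂)` differentiated in `s` within
  `S`, on it by continuity of both sides;
* `IsSmoothSpaceTimeOn.timeDerivWithin_angVelQuot / _angVortQuot / _radVelQuot` —
  `∂ₜΦ = angVelQuot (∂ₜu t)`, `∂ₜΩ = angVortQuot (∂ₜu t)` (`S ⊆ closure (interior S)`, mixed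
  partials), `∂ₜW = radVelQuot (∂ₜu t)` for axisymmetric jointly smooth `u`.

## Mathlib / tree search

Tree: `contDiffOn_parametric_intervalIntegral_prod`,
`interior_nonempty_of_convex_of_uniqueDiffWithinAt` (`SpaceTimeParametricIntegral`),
`IsSmoothSpaceTimeOn.fderiv_slice_apply`, `.timeDerivWithin`, `.hasDerivWithinAt_timeDerivWithin`,
`.inner`, `.mul`, `isSmoothSpaceTimeOn_const_time` (`EnergyToolkit`, `ClassicalSolutionCalculus`,
`SpaceTimeCalculus`), `IsSmoothSpaceTimeOn.isSmoothSpaceTimeOn_vorticity`,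
`.isAxisymmetric_timeDerivWithin`, `.timeDerivWithin_swirl_eq_swirl`, `.timeDerivWithin_vorticity_eq`
(`AxisymmetricVorticityTransport`, `AxisymQuotientEquations(Omega)`), `cylRadius_sq_mul_radQuot`,
`contDiff_scaleH_uncurry`, `contDiff_scaleFst_uncurry`, `eq_of_eq_off_ker`.  Mathlib:
`HasDerivWithinAt.congr`, `UniqueDiffWithinAt.eq_deriv`, `derivWithin_congr`.
`lean search 'timeDerivWithin_radQuot|angVelQuot_family'`: nothing before this file.

## References

* Z. Lei, Q. S. Zhang, Pacific J. Math. 289 (2017) = arXiv:1505.02628, §4. [LeiZhang2017]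
* T. Y. Hou, C. Li, Comm. Pure Appl. Math. 61 (2008) 661–697, §2. [folklore]
-/

noncomputable section

open MeasureTheory Set Function Filter Topology InnerProductSpace
open scoped RealInnerProductSpace ContDiff

namespace Literature.Analysis.FluidPDE

/-! ### Joint smoothness of the quotient families -/

section Smooth

variable {S : Set ℝ} {F : ℝ → EuclideanSpace ℝ (Fin 3) → ℝ}
  {v : ℝ → EuclideanSpace ℝ (Fin 3) → EuclideanSpace ℝ (Fin 3)}

/-- **The Hadamard quotient of a jointly smooth scalar family is jointly smooth** on `S × ℝ³`
(`S` convex, of unique differentiability): `(t, x) ↦ ∫₀¹ ∂₀(F t)(scaleFst σ x) dσ` is a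
parametric interval integral of an integrand smooth within `univ × (S × ℝ³)`. [folklore] -/
theorem IsSmoothSpaceTimeOn.hadamardQuotFst_family (hF : IsSmoothSpaceTimeOn S F)
    (hc : Convex ℝ S) (hS : UniqueDiffOn ℝ S) :
    IsSmoothSpaceTimeOn S fun t => hadamardQuotFst (F t) := by
  intro z hz
  have hi : (interior S).Nonempty :=
    interior_nonempty_of_convex_of_uniqueDiffWithinAt hc hz.1 (hS z.1 hz.1)
  have hG : IsSmoothSpaceTimeOn S fun t y => fderiv ℝ (F t) y (EuclideanSpace.single 0 1) :=
    hF.fderiv_slice_apply hS _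
  have hA : ContDiff ℝ ∞ fun r : ℝ × (ℝ × EuclideanSpace ℝ (Fin 3)) =>
      ((r.2.1, scaleFst r.1 r.2.2) : ℝ × EuclideanSpace ℝ (Fin 3)) :=
    (contDiff_fst.comp contDiff_snd).prodMk
      (contDiff_scaleFst_uncurry.comp ((contDiff_snd.comp contDiff_snd).prodMk contDiff_fst))
  have hH : ContDiffOn ℝ ∞
      (uncurry (fun t y => fderiv ℝ (F t) y (EuclideanSpace.single 0 1)) ∘
        fun r : ℝ × (ℝ × EuclideanSpace ℝ (Fin 3)) =>
          ((r.2.1, scaleFst r.1 r.2.2) : ℝ × EuclideanSpace ℝ (Fin 3)))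
      (univ ×ˢ (S ×ˢ univ)) :=
    hG.comp hA.contDiffOn fun r hr => ⟨hr.2.1, mem_univ _⟩
  exact contDiffOn_parametric_intervalIntegral_prod hc hi hH 0 1 z hz

/-- The radial derivative quotient `radDerivQuot (F t) = (∂ᵣF t)/r` of a jointly smooth scalar family
is jointly smooth. [folklore] -/
theorem IsSmoothSpaceTimeOn.radDerivQuot_family (hF : IsSmoothSpaceTimeOn S F)
    (hc : Convex ℝ S) (hS : UniqueDiffOn ℝ S) :
    IsSmoothSpaceTimeOn S fun t => radDerivQuot (F t) :=
  (hF.fderiv_slice_apply hS (EuclideanSpace.single 0 1)).hadamardQuotFst_family hc hS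

/-- **The radial quotient `radQuot (F t)` of a jointly smooth scalar family is jointly smooth** on
`S × ℝ³` (`(t, x) ↦ ∫₀¹ s · radDerivQuot (F t) (scaleH s x) ds`). [folklore] -/
theorem IsSmoothSpaceTimeOn.radQuot_family (hF : IsSmoothSpaceTimeOn S F)
    (hc : Convex ℝ S) (hS : UniqueDiffOn ℝ S) :
    IsSmoothSpaceTimeOn S fun t => radQuot (F t) := by
  intro z hz
  have hi : (interior S).Nonempty :=
    interior_nonempty_of_convex_of_uniqueDiffWithinAt hc hz.1 (hS z.1 hz.1)
  have hq : IsSmoothSpaceTimeOn S fun t => radDerivQuot (F t) := hF.radDerivQuot_family hc hS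
  have hA : ContDiff ℝ ∞ fun r : ℝ × (ℝ × EuclideanSpace ℝ (Fin 3)) =>
      ((r.2.1, scaleH r.1 r.2.2) : ℝ × EuclideanSpace ℝ (Fin 3)) :=
    (contDiff_fst.comp contDiff_snd).prodMk
      (contDiff_scaleH_uncurry.comp ((contDiff_snd.comp contDiff_snd).prodMk contDiff_fst))
  have hH : ContDiffOn ℝ ∞ (fun r : ℝ × (ℝ × EuclideanSpace ℝ (Fin 3)) =>
      r.1 * (uncurry (fun t => radDerivQuot (F t)) ∘
        fun r : ℝ × (ℝ × EuclideanSpace ℝ (Fin 3)) =>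
          ((r.2.1, scaleH r.1 r.2.2) : ℝ × EuclideanSpace ℝ (Fin 3))) r)
      (univ ×ˢ (S ×ˢ univ)) :=
    contDiffOn_fst.mul (hq.comp hA.contDiffOn fun r hr => ⟨hr.2.1, mem_univ _⟩)
  exact contDiffOn_parametric_intervalIntegral_prod hc hi hH 0 1 z hz

/-- The swirl family `Γ = swirl (u t)` of a jointly smooth field is jointly smooth. [folklore] -/
theorem IsSmoothSpaceTimeOn.swirl_family (h : IsSmoothSpaceTimeOn S v) :
    IsSmoothSpaceTimeOn S fun t => swirl (v t) := by
  have h1 : (fun t => swirl (v t)) = fun t x => ⟪rotGenL x, v t x⟫ := by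
    funext t x
    rw [swirl_eq_inner_rotGen, rotGenL_apply]
  rw [h1]
  exact (isSmoothSpaceTimeOn_const_time rotGenL.contDiff S).inner h

/-- The family `x₀u₀ + x₁u₁ = r uʳ` of a jointly smooth field is jointly smooth. [folklore] -/
theorem IsSmoothSpaceTimeOn.horizontalInner_family (h : IsSmoothSpaceTimeOn S v) :
    IsSmoothSpaceTimeOn S fun t x => x 0 * v t x 0 + x 1 * v t x 1 := by
  have h1 : (fun t (x : EuclideanSpace ℝ (Fin 3)) => x 0 * v t x 0 + x 1 * v t x 1) =
      fun t x => swirl (fun y => rotGen (v t y)) x := by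
    funext t x
    simp only [swirl, rotGen_apply_zero, rotGen_apply_one]
    ring
  rw [h1]
  exact (h.clm rotGenL).swirl_family

/-- **`Φ = u^θ/r` is jointly smooth** along a jointly smooth field (`S` convex, of unique
differentiability). [folklore] -/
theorem IsSmoothSpaceTimeOn.angVelQuot_family (h : IsSmoothSpaceTimeOn S v) (hc : Convex ℝ S)
    (hS : UniqueDiffOn ℝ S) : IsSmoothSpaceTimeOn S fun t => angVelQuot (v t) :=
  h.swirl_family.radQuot_family hc hS

/-- **`Ω = ω^θ/r` is jointly smooth** along a jointly smooth field. [folklore] -/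
theorem IsSmoothSpaceTimeOn.angVortQuot_family (h : IsSmoothSpaceTimeOn S v) (hc : Convex ℝ S)
    (hS : UniqueDiffOn ℝ S) : IsSmoothSpaceTimeOn S fun t => angVortQuot (v t) :=
  (h.isSmoothSpaceTimeOn_vorticity hS).swirl_family.radQuot_family hc hS

/-- **`W = uʳ/r` is jointly smooth** along a jointly smooth field. [folklore] -/
theorem IsSmoothSpaceTimeOn.radVelQuot_family (h : IsSmoothSpaceTimeOn S v) (hc : Convex ℝ S)
    (hS : UniqueDiffOn ℝ S) : IsSmoothSpaceTimeOn S fun t => radVelQuot (v t) :=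
  h.horizontalInner_family.radQuot_family hc hS

end Smooth

/-! ### `∂ₜ` commutes with the radial quotient -/

section TimeDeriv

variable {S : Set ℝ} {F : ℝ → EuclideanSpace ℝ (Fin 3) → ℝ}
  {v : ℝ → EuclideanSpace ℝ (Fin 3) → EuclideanSpace ℝ (Fin 3)}

/-- The time derivative of a family of axisymmetric scalars is an axisymmetric scalar. [folklore] -/
theorem isAxisymmetricScalar_timeDerivWithin (hax : ∀ s ∈ S, IsAxisymmetricScalar (F s)) {t : ℝ}
    (ht : t ∈ S) : IsAxisymmetricScalar (FluidPDE.timeDerivWithin S F t) := by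
  intro θ x
  simp only [timeDerivWithin_apply]
  exact derivWithin_congr (fun s hs => hax s hs θ x) (hax t ht θ x)

/-- **`∂ₜ (radQuot (F ·)) = radQuot (∂ₜ F)`**: for a scalar family `F` jointly smooth on `S × ℝ³`
(`S` convex, of unique differentiability) with axisymmetric slices, at every `t ∈ S` and EVERY
`x`, `FluidPDE.timeDerivWithin S (fun s => radQuot (F s)) t x = radQuot (FluidPDE.timeDerivWithin S F t) x`.  Off
the plane `{x₀ = 0}`: Hadamard's identity `r² radQuot (F s) x = F s x − F s (0,0,x₂)`
(`cylRadius_sq_mul_radQuot`) differentiated in `s` within `S`, and the same identity for the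
axisymmetric slice `∂ₜF t`; on the plane by continuity of both sides (both are slices of jointly
smooth families). [folklore] -/
theorem IsSmoothSpaceTimeOn.timeDerivWithin_radQuot (hF : IsSmoothSpaceTimeOn S F)
    (hc : Convex ℝ S) (hS : UniqueDiffOn ℝ S) (hax : ∀ s ∈ S, IsAxisymmetricScalar (F s))
    {t : ℝ} (ht : t ∈ S) (x : EuclideanSpace ℝ (Fin 3)) :
    FluidPDE.timeDerivWithin S (fun s => radQuot (F s)) t x = radQuot (FluidPDE.timeDerivWithin S F t) x := by
  have hRQ : IsSmoothSpaceTimeOn S fun s => radQuot (F s) := hF.radQuot_family hc hS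
  have hF' : IsSmoothSpaceTimeOn S (FluidPDE.timeDerivWithin S F) := hF.timeDerivWithin hS
  have hF't : ContDiff ℝ 2 (FluidPDE.timeDerivWithin S F t) := (hF'.contDiff_slice ht).of_le (by norm_cast)
  have hFs : ∀ s ∈ S, ContDiff ℝ 2 (F s) := fun s hs => (hF.contDiff_slice hs).of_le (by norm_cast)
  have hax' : IsAxisymmetricScalar (FluidPDE.timeDerivWithin S F t) := isAxisymmetricScalar_timeDerivWithin hax ht
  have hL : Continuous (FluidPDE.timeDerivWithin S (fun s => radQuot (F s)) t) :=
    ((hRQ.timeDerivWithin hS).contDiff_slice ht).continuous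
  have hR : Continuous (radQuot (FluidPDE.timeDerivWithin S F t)) := continuous_radQuot hF't
  refine eq_of_eq_off_ker (EuclideanSpace.proj (0 : Fin 3)) ⟨EuclideanSpace.single 0 1, by simp⟩
    hL hR (fun z hz => ?_) x
  have hz0 : z 0 ≠ 0 := by simpa using hz
  have hr : cylRadius z ^ 2 ≠ 0 :=
    pow_ne_zero 2 fun h => hz0 ((cylRadius_eq_zero_iff z).1 h).1
  -- Hadamard's identity along the flow and for the time derivative
  have hid : ∀ s ∈ S, cylRadius z ^ 2 * radQuot (F s) z = F s z - F s (scaleH 0 z) :=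
    fun s hs => cylRadius_sq_mul_radQuot (hFs s hs) (hax s hs) z
  have hid' : cylRadius z ^ 2 * radQuot (FluidPDE.timeDerivWithin S F t) z =
      FluidPDE.timeDerivWithin S F t z - FluidPDE.timeDerivWithin S F t (scaleH 0 z) :=
    cylRadius_sq_mul_radQuot hF't hax' z
  -- differentiate `s ↦ F s z - F s (scaleH 0 z)` within `S` at `t` in two ways
  have hd1 : HasDerivWithinAt (fun s => cylRadius z ^ 2 * radQuot (F s) z)
      (cylRadius z ^ 2 * FluidPDE.timeDerivWithin S (fun s => radQuot (F s)) t z) S t :=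
    (hRQ.hasDerivWithinAt_timeDerivWithin hS ht z).const_mul _
  have hd2 : HasDerivWithinAt (fun s => F s z - F s (scaleH 0 z))
      (FluidPDE.timeDerivWithin S F t z - FluidPDE.timeDerivWithin S F t (scaleH 0 z)) S t :=
    (hF.hasDerivWithinAt_timeDerivWithin hS ht z).sub
      (hF.hasDerivWithinAt_timeDerivWithin hS ht (scaleH 0 z))
  have hd3 : HasDerivWithinAt (fun s => F s z - F s (scaleH 0 z))
      (cylRadius z ^ 2 * FluidPDE.timeDerivWithin S (fun s => radQuot (F s)) t z) S t :=
    hd1.congr (fun s hs => (hid s hs).symm) (hid t ht).symm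
  have heq := (hS t ht).eq_deriv _ hd2 hd3
  rw [← hid'] at heq
  exact (mul_left_cancel₀ hr heq).symm

/-- **`∂ₜ Φ = angVelQuot (∂ₜ u)`** for an axisymmetric jointly smooth field (`Φ = angVelQuot = u^θ/r`,
`∂ₜ Γ = swirl (∂ₜu)`). [folklore] -/
theorem IsSmoothSpaceTimeOn.timeDerivWithin_angVelQuot (h : IsSmoothSpaceTimeOn S v)
    (hc : Convex ℝ S) (hS : UniqueDiffOn ℝ S) (hax : ∀ s ∈ S, IsAxisymmetric (v s)) {t : ℝ}
    (ht : t ∈ S) (x : EuclideanSpace ℝ (Fin 3)) :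
    FluidPDE.timeDerivWithin S (fun s => angVelQuot (v s)) t x = angVelQuot (FluidPDE.timeDerivWithin S v t) x := by
  have h1 := h.swirl_family.timeDerivWithin_radQuot hc hS
    (fun s hs => (hax s hs).isAxisymmetricScalar_swirl) ht x
  have h2 : FluidPDE.timeDerivWithin S (fun s => swirl (v s)) t = swirl (FluidPDE.timeDerivWithin S v t) :=
    funext fun y => h.timeDerivWithin_swirl_eq_swirl ht y
  rw [h2] at h1
  exact h1

/-- **`∂ₜ Ω = angVortQuot (∂ₜ u)`** for an axisymmetric jointly smooth field on a time set
`S ⊆ closure (interior S)` (`Ω = angVortQuot = ω^θ/r`, `∂ₜ ω = curl (∂ₜu)`). [folklore] -/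
theorem IsSmoothSpaceTimeOn.timeDerivWithin_angVortQuot (h : IsSmoothSpaceTimeOn S v)
    (hc : Convex ℝ S) (hS : UniqueDiffOn ℝ S) (hcl : S ⊆ closure (interior S))
    (hax : ∀ s ∈ S, IsAxisymmetric (v s)) {t : ℝ} (ht : t ∈ S) (x : EuclideanSpace ℝ (Fin 3)) :
    FluidPDE.timeDerivWithin S (fun s => angVortQuot (v s)) t x = angVortQuot (FluidPDE.timeDerivWithin S v t) x := by
  have hω : IsSmoothSpaceTimeOn S (vorticity v) := h.isSmoothSpaceTimeOn_vorticity hS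
  have haxω : ∀ s ∈ S, IsAxisymmetric (vorticity v s) := fun s hs =>
    (hax s hs).curl ((h.contDiff_slice hs).differentiable (by simp))
  have h1 := hω.swirl_family.timeDerivWithin_radQuot hc hS
    (fun s hs => (haxω s hs).isAxisymmetricScalar_swirl) ht x
  have h2 : FluidPDE.timeDerivWithin S (fun s => swirl (vorticity v s)) t =
      swirl (FluidPDE.curl (FluidPDE.timeDerivWithin S v t)) := by
    funext y
    rw [hω.timeDerivWithin_swirl_eq_swirl ht y, h.timeDerivWithin_vorticity_eq hS hcl ht]
  rw [h2] at h1
  exact h1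

/-- `∂ₜ (x₀u₀ + x₁u₁) = x₀(∂ₜu)₀ + x₁(∂ₜu)₁`. [folklore] -/
theorem IsSmoothSpaceTimeOn.timeDerivWithin_horizontalInner (h : IsSmoothSpaceTimeOn S v)
    (hS : UniqueDiffOn ℝ S) {t : ℝ} (ht : t ∈ S) (x : EuclideanSpace ℝ (Fin 3)) :
    FluidPDE.timeDerivWithin S (fun s y => y 0 * v s y 0 + y 1 * v s y 1) t x =
      x 0 * FluidPDE.timeDerivWithin S v t x 0 + x 1 * FluidPDE.timeDerivWithin S v t x 1 := by
  have hd : HasDerivWithinAt (fun s => v s x) (FluidPDE.timeDerivWithin S v t x) S t :=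
    h.hasDerivWithinAt_timeDerivWithin hS ht x
  have h0 : HasDerivWithinAt (fun s => v s x 0) (FluidPDE.timeDerivWithin S v t x 0) S t := by
    simpa [Function.comp_def] using
      ((EuclideanSpace.proj (0 : Fin 3) : EuclideanSpace ℝ (Fin 3) →L[ℝ] ℝ).hasFDerivAt
        (x := v t x)).comp_hasDerivWithinAt t hd
  have h1 : HasDerivWithinAt (fun s => v s x 1) (FluidPDE.timeDerivWithin S v t x 1) S t := by
    simpa [Function.comp_def] using
      ((EuclideanSpace.proj (1 : Fin 3) : EuclideanSpace ℝ (Fin 3) →L[ℝ] ℝ).hasFDerivAt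
        (x := v t x)).comp_hasDerivWithinAt t hd
  have hsum := (h0.const_mul (x 0)).add (h1.const_mul (x 1))
  simp only [timeDerivWithin_apply]
  exact hsum.derivWithin (hS t ht)

/-- **`∂ₜ W = radVelQuot (∂ₜ u)`** for an axisymmetric jointly smooth field (`W = radVelQuot = uʳ/r`).
[folklore] -/
theorem IsSmoothSpaceTimeOn.timeDerivWithin_radVelQuot (h : IsSmoothSpaceTimeOn S v)
    (hc : Convex ℝ S) (hS : UniqueDiffOn ℝ S) (hax : ∀ s ∈ S, IsAxisymmetric (v s)) {t : ℝ}
    (ht : t ∈ S) (x : EuclideanSpace ℝ (Fin 3)) :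
    FluidPDE.timeDerivWithin S (fun s => radVelQuot (v s)) t x = radVelQuot (FluidPDE.timeDerivWithin S v t) x := by
  have h1 := h.horizontalInner_family.timeDerivWithin_radQuot hc hS
    (fun s hs => (hax s hs).isAxisymmetricScalar_horizontal_inner) ht x
  have h2 : FluidPDE.timeDerivWithin S (fun s (y : EuclideanSpace ℝ (Fin 3)) => y 0 * v s y 0 + y 1 * v s y 1) t =
      fun y => y 0 * FluidPDE.timeDerivWithin S v t y 0 + y 1 * FluidPDE.timeDerivWithin S v t y 1 :=
    funext fun y => h.timeDerivWithin_horizontalInner hS ht y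
  rw [h2] at h1
  exact h1

end TimeDeriv

end Literature.Analysis.FluidPDE

end
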